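import Summits.NavierStokesRegularity.NavierStokesRegularity.Theses.AxisymmetricExtremality
import Summits.NavierStokesRegularity.NavierStokesRegularity.Theorems.AxisymmetricExtremalityAxisymmetricKatoGlobalStubSereginLogSwirlOriginStep3KeyUnconditional
import Summits.NavierStokesRegularity.NavierStokesRegularity.Theorems.AxisymmetricExtremalityAxisymmetricKatoGlobalStubSereginLogSwirlOriginStep1CutoffPointwise
import Literature.Analysis.FluidPDE.TaoEnstrophyLocalisation
import HarnessLib

/-!
# Seregin 2022, §2 Step 1 ⇒ Step 3: the pointwise constants `M, P₀, …, P₄, L` of the key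
# estimate from sup-norm bounds of `v, Dv, D²v` on `supp ∇ζ ∪ (supp ζ ∩ {ϱ ≥ r₁})` —
# crux stmt-NavierStokesRegularity-15453 (`AxisymmetricExtremality.AxisymmetricKatoGlobal`), line registered, support for stub `stub_sereginLogSwirlOrigin`

Support file (`--supports stmt-NavierStokesRegularity-15453`; theorems only, everything proved)
toward the registered stub `stub_sereginLogSwirlOrigin` = the named fact
`Literature.Analysis.FluidPDE.seregin2022_logSwirl_regularAtOrigin` (G. Seregin, J. Math. Fluid
Mech. 24 (2022), Paper 27 = arXiv:2201.00153, §2).  The landed key estimate of Step 3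
(`cutoff_energy_keyEstimate_unconditional`, `…Step3KeyUnconditional.lean`) takes, at every time
of the slab, the pointwise hypotheses

* `hfar`: `|(v_θ/r)(ζΓ)(ζΦ)| ≤ M` on `{ϱ ≥ r₁}`,
* `hP0`: `|v_θ| ‖∇(ζ v_r/r)‖ ≤ P₀` on `{ϱ ≥ r₁}`,
* `hP1`: `|v_r/r| |v_θ| ‖∇ζ‖ ≤ P₁`, `hP2`: `|ζΦ| |v_θ| ‖∇ζ‖ ‖∇(v_r/r)‖ ≤ P₂` everywhere,
* `hP3`: `|∂₃(∂₃ζ v_r/r − q_ζ v₃)| ≤ P₃`, `hP4`: `|q_{∇ζ·v}| ≤ P₄` on `{∇ζ ≠ 0}`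

(`Γ = angVortQuot`, `Φ = radVelQuot ∘ curl`, `v_r/r = radVelQuot`, `v_θ = swirlVelocity`,
`v_θ/r = angVelQuot`, `q = radDerivQuot = (∂ᵣ·)/r`), and the Step-4 assembly
(`isRegularAtOrigin_of_step3Bounds`) takes `|v| ≤ L`, `|Φ| ≤ L` on `{∇ζ ≠ 0}`.  The paper
(Step 1, arXiv p. 5; proof of Lemma 2.1; Step 3 "`C(v, η)`", "`(1/r₁)C(v, η)`") obtains all of
them from: "In the set `supp |∇η|`, functions `v`, `∇v`, and `∇²v` are bounded".  This file
proves exactly that derivation, for one time slice: if `‖v‖ ≤ D₀`, `‖Dv‖ ≤ D₁`, `‖D²v‖ ≤ D₂`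
on a set `K ⊇ tsupport (∇ζ) ∪ (tsupport ζ ∩ {ϱ ≥ r₁})` (the regular region of the Step-1
cut-off, `exists_step1_cutoff`), and `‖∇ζ‖ ≤ Z₁`, `‖D²ζ‖ ≤ Z₂`, `‖D³ζ‖ ≤ Z₃`, `|q_ζ| ≤ Q₀`,
`‖∇q_ζ‖ ≤ Q₁` (`exists_cutoff_derivBounds`), then the six hypotheses hold with the explicit
polynomial constants

* `M = D₁ (κD₂)²`, `P₀ = D₀D₁Z₁ + 4D₁²`, `P₁ = D₁D₀Z₁`, `P₂ = κD₂ Z₁ (4D₁²)`,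
  `P₃ = Z₁D₂ + Z₂D₁ + Q₀D₁ + Q₁D₀`, `P₄ = Z₁D₂ + 2Z₂D₁ + Z₃D₀`, `L = D₀`, `L_Φ = κD₂`

(`κ = ‖curlCLM‖`, `‖D(curl v)‖ ≤ κ‖D²v‖`), by the infinitesimal bounds of the sibling
`…Step1CutoffPointwise` (`|v_θ| ‖∇(v_r/r)‖ ≤ 4‖Dv‖²`, `|∂₃(v_r/r)| ≤ ‖D²v‖`, `|q_T| ≤ ‖D²T‖`)
and of `AxisymQuotientBounds` (`|v_r/r|, |v_θ/r| ≤ ‖Dv‖`, `|Γ|, |Φ| ≤ ‖Dω‖`).  Registered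
sub-goal: `step3_pointwiseConstants` (the six bounds bundled).  The integrated hypothesis `hcut`
(`Bcut`) and the energy/measurability inputs of Step 4 are in sibling files.

## Mathlib / tree search

Tree (besides the above): `norm_fderiv_curl_le` (`TaoEnstrophyLocalisation`),
`radDerivQuot_eq_zero_of_notMem_tsupport_fderiv` (`…Step3KeyUnconditional`),
`fderiv_eq_zero_of_forall_notMem` (`…CutoffDivCurl`), `IsAxisymmetricScalar.fderiv_rotZ_apply_rotZ`,
`contDiff_radDerivQuot`, `continuous_radDerivQuot`. Mathlib: `norm_iteratedFDeriv_clm_apply`,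
`Continuous.bounded_above_of_compact_support`, `HasCompactSupport.iteratedFDeriv/.fderiv`,
`image_eq_zero_of_notMem_tsupport`, `PiLp.norm_apply_le` (`|w₂| ≤ ‖w‖`, cf. the Barriers-side
`abs_apply_two_le_norm`).

## References

* G. Seregin, J. Math. Fluid Mech. 24 (2022), Paper No. 27 = arXiv:2201.00153, §2 Step 1
  (arXiv p. 5), Lemma 2.1 (p. 5, `C(v, η)`), Step 3 (pp. 6–7, `C(v, η)`, `C(v, η, r₁)`). [`Seregin2022LocalAxisym`]
-/

noncomputable section

open Set Filter Topology Function Metric MeasureTheory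
open scoped ContDiff
open Literature.Analysis.FluidPDE

-- `<Problem> = <Summit>` duplicates a namespace component by design (lakefile sets the same option).
set_option linter.dupNamespace false

namespace Summit.NavierStokesRegularity.NavierStokesRegularity.Theorems.AxisymmetricKatoGlobal.EulerScaling

/-! ### The derivative bounds of the cut-off -/

section CutoffBounds

variable {ζ : EuclideanSpace ℝ (Fin 3) → ℝ}

/-- **The cut-off constants exist**: for `ζ ∈ C⁴` axisymmetric with compact support there are
`Z₁, Z₂, Z₃, Q₀, Q₁ ≥ 0` with `‖∇ζ‖ ≤ Z₁`, `‖D²ζ‖ ≤ Z₂`, `‖D³ζ‖ ≤ Z₃`, `|q_ζ| ≤ Q₀`,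
`‖∇q_ζ‖ ≤ Q₁` everywhere (`q_ζ = radDerivQuot ζ = (∂ᵣζ)/r`, continuous and vanishing off
`tsupport ∇ζ`). For the Step-1 cut-off these are the paper's `c/r₀ᵏ`, `c/δᵏ`. [folklore] -/
theorem exists_cutoff_derivBounds (hζ : ContDiff ℝ 4 ζ) (hζc : HasCompactSupport ζ)
    (hζax : IsAxisymmetricScalar ζ) :
    ∃ Z₁ Z₂ Z₃ Q₀ Q₁ : ℝ, 0 ≤ Z₁ ∧ 0 ≤ Z₂ ∧ 0 ≤ Z₃ ∧ 0 ≤ Q₀ ∧ 0 ≤ Q₁ ∧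
      (∀ x, ‖fderiv ℝ ζ x‖ ≤ Z₁) ∧ (∀ x, ‖iteratedFDeriv ℝ 2 ζ x‖ ≤ Z₂) ∧
      (∀ x, ‖iteratedFDeriv ℝ 3 ζ x‖ ≤ Z₃) ∧ (∀ x, |radDerivQuot ζ x| ≤ Q₀) ∧
      (∀ x, ‖fderiv ℝ (radDerivQuot ζ) x‖ ≤ Q₁) := by
  have hζ2 : ContDiff ℝ 2 ζ := hζ.of_le (by norm_num)
  obtain ⟨Z₁, hZ₁⟩ := (hζ.continuous_fderiv (by norm_num)).bounded_above_of_compact_support (hζc.fderiv ℝ)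
  obtain ⟨Z₂, hZ₂⟩ := (hζ.continuous_iteratedFDeriv (m := 2) (by norm_num)).bounded_above_of_compact_support
    (hζc.iteratedFDeriv (𝕜 := ℝ) 2)
  obtain ⟨Z₃, hZ₃⟩ := (hζ.continuous_iteratedFDeriv (m := 3) (by norm_num)).bounded_above_of_compact_support
    (hζc.iteratedFDeriv (𝕜 := ℝ) 3)
  have hq2 : ContDiff ℝ 2 (radDerivQuot ζ) := contDiff_radDerivQuot (n := 2) (by exact_mod_cast hζ)
  have hqc : HasCompactSupport (radDerivQuot ζ) :=
    IsCompact.of_isClosed_subset (hζc.fderiv ℝ) (isClosed_tsupport _)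
      (closure_minimal (fun x hx => by_contra fun h' =>
        hx (radDerivQuot_eq_zero_of_notMem_tsupport_fderiv hζ2 hζax h')) (isClosed_tsupport _))
  obtain ⟨Q₀, hQ₀⟩ := hq2.continuous.bounded_above_of_compact_support hqc
  obtain ⟨Q₁, hQ₁⟩ := (hq2.continuous_fderiv (by norm_num)).bounded_above_of_compact_support (hqc.fderiv ℝ)
  refine ⟨Z₁, Z₂, Z₃, Q₀, Q₁, (norm_nonneg _).trans (hZ₁ 0), (norm_nonneg _).trans (hZ₂ 0),
    (norm_nonneg _).trans (hZ₃ 0), (norm_nonneg _).trans (hQ₀ 0), (norm_nonneg _).trans (hQ₁ 0),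
    hZ₁, hZ₂, hZ₃, fun x => ?_, hQ₁⟩
  rw [← Real.norm_eq_abs]
  exact hQ₀ x

end CutoffBounds

/-! ### The six pointwise hypotheses of the key estimate -/

section Pointwise

variable {u : EuclideanSpace ℝ (Fin 3) → EuclideanSpace ℝ (Fin 3)} {ζ : EuclideanSpace ℝ (Fin 3) → ℝ}
  {K : Set (EuclideanSpace ℝ (Fin 3))} {r₁ D₀ D₁ D₂ Z₁ Z₂ Z₃ Q₀ Q₁ : ℝ}

/-- Points where `∇ζ ≠ 0` lie in every `K ⊇ tsupport ∇ζ`. [folklore] -/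
theorem mem_of_fderiv_ne_zero (hK : tsupport (fderiv ℝ ζ) ⊆ K) {x : EuclideanSpace ℝ (Fin 3)}
    (hx : fderiv ℝ ζ x ≠ 0) : x ∈ K :=
  hK (subset_tsupport _ (mem_support.2 hx))

/-- **`hfar` (far-field `M`)**: on `{ϱ ≥ r₁}`, `|(v_θ/r)(ζΓ)(ζΦ)| ≤ D₁(κD₂)²` when `‖Dv‖ ≤ D₁`,
`‖D²v‖ ≤ D₂` on `K ⊇ tsupport ζ ∩ {ϱ ≥ r₁}` and `0 ≤ ζ ≤ 1` (`|v_θ/r| ≤ ‖Dv‖`,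
`|Γ|, |Φ| ≤ ‖Dω‖ ≤ κ‖D²v‖`; off `tsupport ζ` the product vanishes). Seregin's
"`(1/r₁)C(v, η)`" term of `B₃`. [cite: Seregin2022LocalAxisym, §2 Step 3, estimate of B₃ (arXiv:2201.00153 p. 6)] -/
theorem far_bound (hu : ContDiff ℝ 3 u) (hax : IsAxisymmetric u) (hζ01 : ∀ x, 0 ≤ ζ x ∧ ζ x ≤ 1)
    (hKfar : ∀ x ∈ tsupport ζ, r₁ ≤ cylRadius x → x ∈ K) (hD₁ : 0 ≤ D₁) (hD₂ : 0 ≤ D₂)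
    (h1 : ∀ x ∈ K, ‖fderiv ℝ u x‖ ≤ D₁) (h2 : ∀ x ∈ K, ‖iteratedFDeriv ℝ 2 u x‖ ≤ D₂)
    (x : EuclideanSpace ℝ (Fin 3)) (hx : r₁ ≤ cylRadius x) :
    |angVelQuot u x * (ζ x * angVortQuot u x) * (ζ x * radVelQuot (curl u) x)| ≤
      D₁ * (‖curlCLM‖ * D₂) ^ 2 := by
  have hu2 : ContDiff ℝ 2 u := hu.of_le (by norm_num)
  by_cases hxs : x ∈ tsupport ζ
  · have hxK : x ∈ K := hKfar x hxs hx
    have ha : |angVelQuot u x| ≤ D₁ := (hax.abs_angVelQuot_le_norm_fderiv hu2 x).trans (h1 x hxK)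
    have hω : ‖fderiv ℝ (curl u) x‖ ≤ ‖curlCLM‖ * D₂ :=
      (norm_fderiv_curl_le hu2 x).trans (mul_le_mul_of_nonneg_left (h2 x hxK) (norm_nonneg curlCLM))
    have hΓ : |angVortQuot u x| ≤ ‖curlCLM‖ * D₂ := (hax.abs_angVortQuot_le_norm_fderiv_curl hu x).trans hω
    have hΦ : |radVelQuot (curl u) x| ≤ ‖curlCLM‖ * D₂ :=
      (hax.abs_radVelQuot_curl_le_norm_fderiv_curl hu x).trans hω
    have hζ : |ζ x| ≤ 1 := by rw [abs_of_nonneg (hζ01 x).1]; exact (hζ01 x).2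
    rw [abs_mul, abs_mul, abs_mul, abs_mul]
    have hκ : 0 ≤ ‖curlCLM‖ * D₂ := by positivity
    calc |angVelQuot u x| * (|ζ x| * |angVortQuot u x|) * (|ζ x| * |radVelQuot (curl u) x|)
        ≤ D₁ * (1 * (‖curlCLM‖ * D₂)) * (1 * (‖curlCLM‖ * D₂)) := by
          gcongr
      _ = D₁ * (‖curlCLM‖ * D₂) ^ 2 := by ring
  · rw [image_eq_zero_of_notMem_tsupport hxs]
    simp only [zero_mul, mul_zero, abs_zero]
    positivity

/-- **`hP0`**: on `{ϱ ≥ r₁}`, `|v_θ| ‖∇(ζ v_r/r)‖ ≤ D₀D₁Z₁ + 4D₁²`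
(`∇(ζρ) = ρ∇ζ + ζ∇ρ`, `|v_θ||ρ|‖∇ζ‖ ≤ ‖v‖‖Dv‖Z₁`, `|v_θ|ζ‖∇ρ‖ ≤ 4‖Dv‖²` by
`abs_swirlVelocity_mul_norm_fderiv_radVelQuot_le`; off `tsupport ζ` the gradient vanishes).
[cite: Seregin2022LocalAxisym, §2 Step 3, estimate of A₀/A'₃₁ (arXiv:2201.00153 pp. 6–7)] -/
theorem P0_bound (hu : ContDiff ℝ 3 u) (hax : IsAxisymmetric u) (hζ : ContDiff ℝ 1 ζ)
    (hζ01 : ∀ x, 0 ≤ ζ x ∧ ζ x ≤ 1) (hZ₁ : ∀ x, ‖fderiv ℝ ζ x‖ ≤ Z₁)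
    (hKfar : ∀ x ∈ tsupport ζ, r₁ ≤ cylRadius x → x ∈ K) (hD₀ : 0 ≤ D₀) (hD₁ : 0 ≤ D₁)
    (hZ₁0 : 0 ≤ Z₁) (h0 : ∀ x ∈ K, ‖u x‖ ≤ D₀) (h1 : ∀ x ∈ K, ‖fderiv ℝ u x‖ ≤ D₁)
    (x : EuclideanSpace ℝ (Fin 3)) (hx : r₁ ≤ cylRadius x) :
    |swirlVelocity u x| * ‖fderiv ℝ (fun y => ζ y * radVelQuot u y) x‖ ≤ D₀ * D₁ * Z₁ + 4 * D₁ ^ 2 := by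
  have hu2 : ContDiff ℝ 2 u := hu.of_le (by norm_num)
  have hρ1 : ContDiff ℝ 1 (radVelQuot u) := contDiff_radVelQuot (n := 1) (by exact_mod_cast hu)
  by_cases hxs : x ∈ tsupport ζ
  · have hxK : x ∈ K := hKfar x hxs hx
    have hθ : |swirlVelocity u x| ≤ D₀ := (abs_swirlVelocity_le u x).trans (h0 x hxK)
    have hρ : |radVelQuot u x| ≤ D₁ := (hax.abs_radVelQuot_le_norm_fderiv hu2 x).trans (h1 x hxK)
    have hkey : |swirlVelocity u x| * ‖fderiv ℝ (radVelQuot u) x‖ ≤ 4 * D₁ ^ 2 :=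
      (abs_swirlVelocity_mul_norm_fderiv_radVelQuot_le u hax hu x).trans (by nlinarith [h1 x hxK, norm_nonneg (fderiv ℝ u x)])
    rw [fderiv_fun_mul (hζ.differentiable one_ne_zero x) (hρ1.differentiable one_ne_zero x)]
    calc |swirlVelocity u x| * ‖ζ x • fderiv ℝ (radVelQuot u) x + radVelQuot u x • fderiv ℝ ζ x‖
        ≤ |swirlVelocity u x| * (|ζ x| * ‖fderiv ℝ (radVelQuot u) x‖ + |radVelQuot u x| * ‖fderiv ℝ ζ x‖) := by
          refine mul_le_mul_of_nonneg_left ((norm_add_le _ _).trans ?_) (abs_nonneg _)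
          rw [norm_smul, norm_smul, Real.norm_eq_abs, Real.norm_eq_abs]
      _ = |ζ x| * (|swirlVelocity u x| * ‖fderiv ℝ (radVelQuot u) x‖) +
          |swirlVelocity u x| * |radVelQuot u x| * ‖fderiv ℝ ζ x‖ := by ring
      _ ≤ 1 * (4 * D₁ ^ 2) + D₀ * D₁ * Z₁ := by
          have hζle : |ζ x| ≤ 1 := by rw [abs_of_nonneg (hζ01 x).1]; exact (hζ01 x).2
          gcongr
          · exact hZ₁ x
      _ = D₀ * D₁ * Z₁ + 4 * D₁ ^ 2 := by ring
  · have h0f : ∀ y ∉ tsupport ζ, ζ y * radVelQuot u y = 0 := fun y hy => by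
      rw [image_eq_zero_of_notMem_tsupport hy, zero_mul]
    rw [fderiv_eq_zero_of_forall_notMem (isClosed_tsupport ζ) h0f hxs, norm_zero, mul_zero]
    positivity

/-- **`hP1`**: `|v_r/r| |v_θ| ‖∇ζ‖ ≤ D₁D₀Z₁` everywhere (zero where `∇ζ = 0`).
[cite: Seregin2022LocalAxisym, §2 Step 3, estimate of A'₃₁ (arXiv:2201.00153 p. 7)] -/
theorem P1_bound (hu : ContDiff ℝ 2 u) (hax : IsAxisymmetric u) (hZ₁ : ∀ x, ‖fderiv ℝ ζ x‖ ≤ Z₁)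
    (hK : tsupport (fderiv ℝ ζ) ⊆ K) (hD₀ : 0 ≤ D₀) (hD₁ : 0 ≤ D₁) (hZ₁0 : 0 ≤ Z₁)
    (h0 : ∀ x ∈ K, ‖u x‖ ≤ D₀) (h1 : ∀ x ∈ K, ‖fderiv ℝ u x‖ ≤ D₁) (x : EuclideanSpace ℝ (Fin 3)) :
    |radVelQuot u x| * |swirlVelocity u x| * ‖fderiv ℝ ζ x‖ ≤ D₁ * D₀ * Z₁ := by
  by_cases hx : fderiv ℝ ζ x = 0
  · rw [hx, norm_zero, mul_zero]; positivity
  · have hxK : x ∈ K := mem_of_fderiv_ne_zero hK hx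
    have hρ : |radVelQuot u x| ≤ D₁ := (hax.abs_radVelQuot_le_norm_fderiv hu x).trans (h1 x hxK)
    have hθ : |swirlVelocity u x| ≤ D₀ := (abs_swirlVelocity_le u x).trans (h0 x hxK)
    gcongr
    exact hZ₁ x

/-- **`hP2`**: `|ζΦ| |v_θ| (‖∇ζ‖ ‖∇(v_r/r)‖) ≤ κD₂ Z₁ (4D₁²)` everywhere (zero where `∇ζ = 0`;
`|v_θ|‖∇(v_r/r)‖ ≤ 4‖Dv‖²` absorbs the `1/ϱ` near the heights).
[cite: Seregin2022LocalAxisym, §2 Step 3, estimate of A₃₂ (arXiv:2201.00153 p. 7)] -/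
theorem P2_bound (hu : ContDiff ℝ 3 u) (hax : IsAxisymmetric u) (hζ01 : ∀ x, 0 ≤ ζ x ∧ ζ x ≤ 1)
    (hZ₁ : ∀ x, ‖fderiv ℝ ζ x‖ ≤ Z₁) (hK : tsupport (fderiv ℝ ζ) ⊆ K) (hD₁ : 0 ≤ D₁)
    (hD₂ : 0 ≤ D₂) (hZ₁0 : 0 ≤ Z₁) (h1 : ∀ x ∈ K, ‖fderiv ℝ u x‖ ≤ D₁)
    (h2 : ∀ x ∈ K, ‖iteratedFDeriv ℝ 2 u x‖ ≤ D₂) (x : EuclideanSpace ℝ (Fin 3)) :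
    |ζ x * radVelQuot (curl u) x| * |swirlVelocity u x| *
        (‖fderiv ℝ ζ x‖ * ‖fderiv ℝ (radVelQuot u) x‖) ≤ ‖curlCLM‖ * D₂ * Z₁ * (4 * D₁ ^ 2) := by
  have hu2 : ContDiff ℝ 2 u := hu.of_le (by norm_num)
  by_cases hx : fderiv ℝ ζ x = 0
  · rw [hx, norm_zero, zero_mul, mul_zero]; positivity
  · have hxK : x ∈ K := mem_of_fderiv_ne_zero hK hx
    have hΦ : |ζ x * radVelQuot (curl u) x| ≤ ‖curlCLM‖ * D₂ := by
      rw [abs_mul]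
      have hζle : |ζ x| ≤ 1 := by rw [abs_of_nonneg (hζ01 x).1]; exact (hζ01 x).2
      calc |ζ x| * |radVelQuot (curl u) x| ≤ 1 * (‖curlCLM‖ * D₂) := by
            refine mul_le_mul hζle ?_ (abs_nonneg _) zero_le_one
            exact (hax.abs_radVelQuot_curl_le_norm_fderiv_curl hu x).trans ((norm_fderiv_curl_le hu2 x).trans
              (mul_le_mul_of_nonneg_left (h2 x hxK) (norm_nonneg curlCLM)))
        _ = ‖curlCLM‖ * D₂ := one_mul _
    have hkey : |swirlVelocity u x| * ‖fderiv ℝ (radVelQuot u) x‖ ≤ 4 * D₁ ^ 2 :=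
      (abs_swirlVelocity_mul_norm_fderiv_radVelQuot_le u hax hu x).trans (by nlinarith [h1 x hxK, norm_nonneg (fderiv ℝ u x)])
    calc |ζ x * radVelQuot (curl u) x| * |swirlVelocity u x| * (‖fderiv ℝ ζ x‖ * ‖fderiv ℝ (radVelQuot u) x‖)
        = |ζ x * radVelQuot (curl u) x| * ‖fderiv ℝ ζ x‖ * (|swirlVelocity u x| * ‖fderiv ℝ (radVelQuot u) x‖) := by ring
      _ ≤ ‖curlCLM‖ * D₂ * Z₁ * (4 * D₁ ^ 2) :=
          mul_le_mul (mul_le_mul hΦ (hZ₁ x) (norm_nonneg _) (mul_nonneg (norm_nonneg curlCLM) hD₂)) hkey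
            (mul_nonneg (abs_nonneg _) (norm_nonneg _))
            (mul_nonneg (mul_nonneg (norm_nonneg curlCLM) hD₂) hZ₁0)

/-- **`hP3`**: on `{∇ζ ≠ 0}`, `|∂₃(∂₃ζ · v_r/r − q_ζ · v₃)| ≤ Z₁D₂ + Z₂D₁ + Q₀D₁ + Q₁D₀`
(product rule at `x`; `|∂₃(v_r/r)| ≤ ‖D²v‖`, `|∂₃∂₃ζ| ≤ ‖D²ζ‖`, `|∂₃v₃| ≤ ‖Dv‖`). The paper's
error term `C(v, η)` of Lemma 2.1 (ii) ("`v₃, v_{r,3}, …, v_{r,3}/r`").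
[cite: Seregin2022LocalAxisym, §2 proof of Lemma 2.1 (arXiv:2201.00153 p. 5), C(v,η)] -/
theorem P3_bound (hu : ContDiff ℝ 3 u) (hax : IsAxisymmetric u) (hζ : ContDiff ℝ 4 ζ)
    (hZ₁ : ∀ x, ‖fderiv ℝ ζ x‖ ≤ Z₁) (hZ₂ : ∀ x, ‖iteratedFDeriv ℝ 2 ζ x‖ ≤ Z₂)
    (hQ₀ : ∀ x, |radDerivQuot ζ x| ≤ Q₀) (hQ₁ : ∀ x, ‖fderiv ℝ (radDerivQuot ζ) x‖ ≤ Q₁)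
    (hK : tsupport (fderiv ℝ ζ) ⊆ K) (hD₀ : 0 ≤ D₀) (hD₁ : 0 ≤ D₁)
    (hZ₁0 : 0 ≤ Z₁) (hQ₀0 : 0 ≤ Q₀)
    (h0 : ∀ x ∈ K, ‖u x‖ ≤ D₀) (h1 : ∀ x ∈ K, ‖fderiv ℝ u x‖ ≤ D₁)
    (h2 : ∀ x ∈ K, ‖iteratedFDeriv ℝ 2 u x‖ ≤ D₂) (x : EuclideanSpace ℝ (Fin 3))
    (hx : fderiv ℝ ζ x ≠ 0) :
    |fderiv ℝ (fun y => fderiv ℝ ζ y (EuclideanSpace.single 2 1) * radVelQuot u y -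
        radDerivQuot ζ y * u y 2) x (EuclideanSpace.single 2 1)| ≤
      Z₁ * D₂ + Z₂ * D₁ + Q₀ * D₁ + Q₁ * D₀ := by
  have hxK : x ∈ K := mem_of_fderiv_ne_zero hK hx
  have hu2 : ContDiff ℝ 2 u := hu.of_le (by norm_num)
  have hζ2 : ContDiff ℝ 2 ζ := hζ.of_le (by norm_num)
  set e₂ : EuclideanSpace ℝ (Fin 3) := EuclideanSpace.single 2 1 with he₂
  have hne₂ : ‖e₂‖ = 1 := by simp [he₂]
  -- the four factors and their differentiability at `x`
  have hf1 : DifferentiableAt ℝ (fun y => fderiv ℝ ζ y e₂) x :=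
    ((contDiff_fderiv_apply_const_succ (n := 1) (by exact_mod_cast hζ2) e₂).differentiable one_ne_zero) x
  have hρd : DifferentiableAt ℝ (radVelQuot u) x :=
    ((contDiff_radVelQuot (n := 1) (by exact_mod_cast hu)).differentiable one_ne_zero) x
  have hq1 : ContDiff ℝ 1 (radDerivQuot ζ) := contDiff_radDerivQuot (n := 1) (by exact_mod_cast hζ.of_le (by norm_num))
  have hqd : DifferentiableAt ℝ (radDerivQuot ζ) x := (hq1.differentiable one_ne_zero) x
  have hud : DifferentiableAt ℝ u x := (hu.differentiable (by norm_num)) x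
  have hu2d : DifferentiableAt ℝ (fun y => u y 2) x := (EuclideanSpace.proj (𝕜 := ℝ) (2 : Fin 3)).differentiableAt.comp x hud
  have hu2f : fderiv ℝ (fun y => u y 2) x e₂ = fderiv ℝ u x e₂ 2 := by
    rw [show (fun y => u y 2) = (EuclideanSpace.proj (𝕜 := ℝ) (2 : Fin 3)) ∘ u from rfl,
      fderiv_comp x (EuclideanSpace.proj (𝕜 := ℝ) (2 : Fin 3)).differentiableAt hud,
      ContinuousLinearMap.fderiv]
    rfl
  rw [fderiv_fun_sub (hf1.fun_mul hρd) (hqd.fun_mul hu2d), fderiv_fun_mul hf1 hρd, fderiv_fun_mul hqd hu2d]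
  simp only [_root_.sub_apply, _root_.add_apply, _root_.FunLike.coe_smul, Pi.smul_apply, smul_eq_mul,
    hu2f]
  -- the eight pointwise bounds
  have b1 : |fderiv ℝ ζ x e₂| ≤ Z₁ := by
    rw [← Real.norm_eq_abs]
    exact ((fderiv ℝ ζ x).le_opNorm e₂).trans (by rw [hne₂, mul_one]; exact hZ₁ x)
  have b2 : |fderiv ℝ (radVelQuot u) x e₂| ≤ D₂ :=
    (abs_fderiv_radVelQuot_single_two_le hax hu x).trans (h2 x hxK)
  have b3 : |radVelQuot u x| ≤ D₁ := (hax.abs_radVelQuot_le_norm_fderiv hu2 x).trans (h1 x hxK)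
  have b4 : |fderiv ℝ (fun y => fderiv ℝ ζ y e₂) x e₂| ≤ Z₂ := by
    rw [← Real.norm_eq_abs]
    refine ((fderiv ℝ (fun y => fderiv ℝ ζ y e₂) x).le_opNorm e₂).trans ?_
    rw [hne₂, mul_one]
    exact (norm_fderiv_fderiv_apply_le hζ2 x e₂).trans (by rw [hne₂, one_mul]; exact hZ₂ x)
  have b5 : |radDerivQuot ζ x| ≤ Q₀ := hQ₀ x
  have b6 : |fderiv ℝ u x e₂ 2| ≤ D₁ := by
    refine (by simpa using PiLp.norm_apply_le (fderiv ℝ u x e₂) 2 : |fderiv ℝ u x e₂ 2| ≤ ‖fderiv ℝ u x e₂‖).trans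
      (((fderiv ℝ u x).le_opNorm e₂).trans ?_)
    rw [hne₂, mul_one]
    exact h1 x hxK
  have b7 : |u x 2| ≤ D₀ :=
    (by simpa using PiLp.norm_apply_le (u x) 2 : |u x 2| ≤ ‖u x‖).trans (h0 x hxK)
  have b8 : |fderiv ℝ (radDerivQuot ζ) x e₂| ≤ Q₁ := by
    rw [← Real.norm_eq_abs]
    exact ((fderiv ℝ (radDerivQuot ζ) x).le_opNorm e₂).trans (by rw [hne₂, mul_one]; exact hQ₁ x)
  calc |fderiv ℝ ζ x e₂ * fderiv ℝ (radVelQuot u) x e₂ + radVelQuot u x * fderiv ℝ (fun y => fderiv ℝ ζ y e₂) x e₂ -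
        (radDerivQuot ζ x * fderiv ℝ u x e₂ 2 + u x 2 * fderiv ℝ (radDerivQuot ζ) x e₂)|
      ≤ |fderiv ℝ ζ x e₂| * |fderiv ℝ (radVelQuot u) x e₂| + |radVelQuot u x| * |fderiv ℝ (fun y => fderiv ℝ ζ y e₂) x e₂| +
        (|radDerivQuot ζ x| * |fderiv ℝ u x e₂ 2| + |u x 2| * |fderiv ℝ (radDerivQuot ζ) x e₂|) := by
          rw [← abs_mul, ← abs_mul, ← abs_mul, ← abs_mul]
          exact (abs_sub _ _).trans (add_le_add (abs_add_le _ _) (abs_add_le _ _))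
    _ ≤ Z₁ * D₂ + D₁ * Z₂ + (Q₀ * D₁ + D₀ * Q₁) := by gcongr
    _ = Z₁ * D₂ + Z₂ * D₁ + Q₀ * D₁ + Q₁ * D₀ := by ring

/-- **`hP4`**: on `{∇ζ ≠ 0}`, `|q_{∇ζ·v}| ≤ Z₁D₂ + 2Z₂D₁ + Z₃D₀`: the scalar `T = Dζ(·)[v(·)]` is
axisymmetric of class `C³`, `|q_T(x)| ≤ ‖D²T(x)‖` (`abs_radDerivQuot_le_norm_iteratedFDeriv_two`), and
Leibniz (`norm_iteratedFDeriv_clm_apply`). The paper's `C(v, η)` of Lemma 2.1 ("`v_{3,r}/r`,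
`v_{3,rr}`"). [cite: Seregin2022LocalAxisym, §2 proof of Lemma 2.1 (arXiv:2201.00153 p. 5), C(v,η)] -/
theorem P4_bound (hu : ContDiff ℝ 3 u) (hax : IsAxisymmetric u) (hζ : ContDiff ℝ 4 ζ)
    (hζax : IsAxisymmetricScalar ζ) (hZ₁ : ∀ x, ‖fderiv ℝ ζ x‖ ≤ Z₁)
    (hZ₂ : ∀ x, ‖iteratedFDeriv ℝ 2 ζ x‖ ≤ Z₂) (hZ₃ : ∀ x, ‖iteratedFDeriv ℝ 3 ζ x‖ ≤ Z₃)
    (hK : tsupport (fderiv ℝ ζ) ⊆ K) (hZ₁0 : 0 ≤ Z₁) (hZ₂0 : 0 ≤ Z₂) (hZ₃0 : 0 ≤ Z₃)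
    (h0 : ∀ x ∈ K, ‖u x‖ ≤ D₀) (h1 : ∀ x ∈ K, ‖fderiv ℝ u x‖ ≤ D₁)
    (h2 : ∀ x ∈ K, ‖iteratedFDeriv ℝ 2 u x‖ ≤ D₂) (x : EuclideanSpace ℝ (Fin 3))
    (hx : fderiv ℝ ζ x ≠ 0) :
    |radDerivQuot (fun y => fderiv ℝ ζ y (u y)) x| ≤ Z₁ * D₂ + 2 * Z₂ * D₁ + Z₃ * D₀ := by
  have hxK : x ∈ K := mem_of_fderiv_ne_zero hK hx
  have hu2 : ContDiff ℝ 2 u := hu.of_le (by norm_num)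
  have hDζ3 : ContDiff ℝ 3 (fderiv ℝ ζ) := hζ.fderiv_right (m := 3) (by norm_num)
  have hDζ2 : ContDiff ℝ 2 (fderiv ℝ ζ) := hDζ3.of_le (by norm_num)
  have hT3 : ContDiff ℝ 3 fun y => fderiv ℝ ζ y (u y) := hDζ3.clm_apply hu
  have hTax : IsAxisymmetricScalar fun y => fderiv ℝ ζ y (u y) := fun θ y => by
    simp only [hax θ y]
    exact hζax.fderiv_rotZ_apply_rotZ (hζ.differentiable (by norm_num)) θ y (u y)
  have hL := norm_iteratedFDeriv_clm_apply (𝕜 := ℝ) (f := fderiv ℝ ζ) (g := u) (N := 2) (n := 2)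
    hDζ2 hu2 x le_rfl
  simp only [Finset.sum_range_succ, Finset.sum_range_zero, zero_add, norm_iteratedFDeriv_fderiv,
    Nat.choose_zero_right, Nat.choose_one_right, Nat.choose_self, Nat.cast_one, Nat.cast_ofNat,
    one_mul] at hL
  have e1 : ‖iteratedFDeriv ℝ (0 + 1) ζ x‖ = ‖fderiv ℝ ζ x‖ := norm_iteratedFDeriv_one ζ
  have e2 : ‖iteratedFDeriv ℝ (2 - 0) u x‖ = ‖iteratedFDeriv ℝ 2 u x‖ := rfl
  have e3 : ‖iteratedFDeriv ℝ (1 + 1) ζ x‖ = ‖iteratedFDeriv ℝ 2 ζ x‖ := rfl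
  have e4 : ‖iteratedFDeriv ℝ (2 - 1) u x‖ = ‖fderiv ℝ u x‖ := norm_iteratedFDeriv_one u
  have e5 : ‖iteratedFDeriv ℝ (2 + 1) ζ x‖ = ‖iteratedFDeriv ℝ 3 ζ x‖ := rfl
  have e6 : ‖iteratedFDeriv ℝ (2 - 2) u x‖ = ‖u x‖ := norm_iteratedFDeriv_zero
  rw [e1, e2, e3, e4, e5, e6] at hL
  calc |radDerivQuot (fun y => fderiv ℝ ζ y (u y)) x|
      ≤ ‖iteratedFDeriv ℝ 2 (fun y => fderiv ℝ ζ y (u y)) x‖ :=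
        abs_radDerivQuot_le_norm_iteratedFDeriv_two _ hT3 hTax x
    _ ≤ ‖fderiv ℝ ζ x‖ * ‖iteratedFDeriv ℝ 2 u x‖ + 2 * ‖iteratedFDeriv ℝ 2 ζ x‖ * ‖fderiv ℝ u x‖ +
        ‖iteratedFDeriv ℝ 3 ζ x‖ * ‖u x‖ := hL
    _ ≤ Z₁ * D₂ + 2 * Z₂ * D₁ + Z₃ * D₀ := by
        gcongr
        exacts [hZ₁ x, h2 x hxK, hZ₂ x, h1 x hxK, hZ₃ x, h0 x hxK]

/-- **Step 4's `L`**: on `{∇ζ ≠ 0}`, `‖v‖ ≤ D₀` and `|Φ| ≤ κD₂`. [cite: Seregin2022LocalAxisym, §2 Step 4 (arXiv:2201.00153 p. 7), boundedness of v and ∇ω on supp ∇η] -/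
theorem L_bound (hu : ContDiff ℝ 3 u) (hax : IsAxisymmetric u) (hK : tsupport (fderiv ℝ ζ) ⊆ K)
    (h0 : ∀ x ∈ K, ‖u x‖ ≤ D₀) (h2 : ∀ x ∈ K, ‖iteratedFDeriv ℝ 2 u x‖ ≤ D₂)
    (x : EuclideanSpace ℝ (Fin 3)) (hx : fderiv ℝ ζ x ≠ 0) :
    ‖u x‖ ≤ D₀ ∧ |radVelQuot (curl u) x| ≤ ‖curlCLM‖ * D₂ := by
  have hxK : x ∈ K := mem_of_fderiv_ne_zero hK hx
  refine ⟨h0 x hxK, (hax.abs_radVelQuot_curl_le_norm_fderiv_curl hu x).trans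
    ((norm_fderiv_curl_le (hu.of_le (by norm_num)) x).trans
      (mul_le_mul_of_nonneg_left (h2 x hxK) (norm_nonneg curlCLM)))⟩

/-! ### The six hypotheses bundled -/

/-- **Seregin 2022, §2 Step 1 ⇒ Step 3: the pointwise constants of the key estimate from
sup-norm bounds on the regular region.** For one time slice: an axisymmetric `v ∈ C³`, an
axisymmetric cut-off `ζ ∈ C⁴` with `0 ≤ ζ ≤ 1` and derivative bounds `Z₁, Z₂, Z₃, Q₀, Q₁`
(`exists_cutoff_derivBounds`), a set `K` containing `tsupport ∇ζ` and `tsupport ζ ∩ {ϱ ≥ r₁}`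
(for the Step-1 cut-off: a compact set of regular top-slice points, `exists_step1_cutoff`), and
`‖v‖ ≤ D₀`, `‖Dv‖ ≤ D₁`, `‖D²v‖ ≤ D₂` on `K` ("in the set `supp |∇η|`, functions `v`, `∇v`, and
`∇²v` are bounded"), the hypotheses `hfar`, `hP0`, `hP1`, `hP2`, `hP3`, `hP4` of
`cutoff_energy_keyEstimate_unconditional` and `|v| ≤ L`, `|Φ| ≤ L_Φ` of
`isRegularAtOrigin_of_step3Bounds` hold at this slice with
`M = D₁(κD₂)²`, `P₀ = D₀D₁Z₁ + 4D₁²`, `P₁ = D₁D₀Z₁`, `P₂ = κD₂Z₁(4D₁²)`,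
`P₃ = Z₁D₂ + Z₂D₁ + Q₀D₁ + Q₁D₀`, `P₄ = Z₁D₂ + 2Z₂D₁ + Z₃D₀`, `L = D₀`, `L_Φ = κD₂`
(`κ = ‖curlCLM‖`) — constants independent of the slice, hence uniform on the final slab once
`D₀, D₁, D₂` are. Registered sub-goal toward `stub_sereginLogSwirlOrigin`. [cite: Seregin2022LocalAxisym, §2 Step 1 (arXiv:2201.00153 p. 5), Lemma 2.1 C(v,η), Step 3 C(v,η), C(v,η,r₁) (pp. 5–7)] -/
theorem step3_pointwiseConstants : ∀ (u : EuclideanSpace ℝ (Fin 3) → EuclideanSpace ℝ (Fin 3)) (ζ : EuclideanSpace ℝ (Fin 3) → ℝ) (K : Set (EuclideanSpace ℝ (Fin 3))) (r₁ D₀ D₁ D₂ Z₁ Z₂ Z₃ Q₀ Q₁ : ℝ), ContDiff ℝ 3 u → IsAxisymmetric u → ContDiff ℝ 4 ζ → IsAxisymmetricScalar ζ → (∀ x, 0 ≤ ζ x ∧ ζ x ≤ 1) → tsupport (fderiv ℝ ζ) ⊆ K → (∀ x ∈ tsupport ζ, r₁ ≤ cylRadius x → x ∈ K) → 0 ≤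 D₀ → 0 ≤ D₁ → 0 ≤ D₂ → 0 ≤ Z₁ → 0 ≤ Z₂ → 0 ≤ Z₃ → 0 ≤ Q₀ → (∀ x, ‖fderiv ℝ ζ x‖ ≤ Z₁) → (∀ x, ‖iteratedFDeriv ℝ 2 ζ x‖ ≤ Z₂) → (∀ x, ‖iteratedFDeriv ℝ 3 ζ x‖ ≤ Z₃) → (∀ x, |radDerivQuot ζ x| ≤ Q₀) → (∀ x, ‖fderiv ℝ (radDerivQuot ζ) x‖ ≤ Q₁) → (∀ x ∈ K, ‖u x‖ ≤ D₀) → (∀ x ∈ K, ‖fderiv ℝ u x‖ ≤ D₁) → (∀ x ∈ K, ‖iteratedFDeriv ℝ 2 u x‖ ≤ D₂) → (∀ x, r₁ ≤ cylRadius x → |angVelQuot u x * (ζ x * angVortQuot u x) * (ζ x * radVelQuot (curl u) x)| ≤ D₁ * (‖curlCLM‖ * D₂) ^ 2) ∧ (∀ x, r₁ ≤ cylRadius x → |swirlVelocity u x| * ‖fderiv ℝ (fun y => ζ y * radVelQuot u y) x‖ ≤ D₀ * D₁ * Z₁ + 4 * D₁ ^ 2) ∧ (∀ x, |radVelQuot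 u x| * |swirlVelocity u x| * ‖fderiv ℝ ζ x‖ ≤ D₁ * D₀ * Z₁) ∧ (∀ x, |ζ x * radVelQuot (curl u) x| * |swirlVelocity u x| * (‖fderiv ℝ ζ x‖ * ‖fderiv ℝ (radVelQuot u) x‖) ≤ ‖curlCLM‖ * D₂ * Z₁ * (4 * D₁ ^ 2)) ∧ (∀ x, fderiv ℝ ζ x ≠ 0 → |fderiv ℝ (fun y => fderiv ℝ ζ y (EuclideanSpace.single 2 1) * radVelQuot u y - radDerivQuot ζ y * u y 2) x (EuclideanSpace.single 2 1)| ≤ Z₁ * D₂ + Z₂ * D₁ + Q₀ * D₁ + Q₁ * D₀) ∧ (∀ x, fderiv ℝ ζ x ≠ 0 → |radDerivQuot (fun y => fderiv ℝ ζ y (u y)) x| ≤ Z₁ * D₂ + 2 * Z₂ * D₁ + Z₃ * D₀) ∧ (∀ x, fderiv ℝ ζ x ≠ 0 → ‖u x‖ ≤ D₀) ∧ (∀ x, fderiv ℝ ζ x ≠ 0 → |radVelQuot (curl u) x| ≤ ‖curlCLM‖ * D₂) := by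
  intro u ζ K r₁ D₀ D₁ D₂ Z₁ Z₂ Z₃ Q₀ Q₁ hu hax hζ hζax hζ01 hK hKfar hD₀ hD₁ hD₂ hZ₁0 hZ₂0 hZ₃0 hQ₀0 hZ₁ hZ₂ hZ₃ hQ₀ hQ₁ h0 h1 h2
  exact ⟨far_bound hu hax hζ01 hKfar hD₁ hD₂ h1 h2,
    P0_bound hu hax (hζ.of_le (by norm_num)) hζ01 hZ₁ hKfar hD₀ hD₁ hZ₁0 h0 h1,
    P1_bound (hu.of_le (by norm_num)) hax hZ₁ hK hD₀ hD₁ hZ₁0 h0 h1,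
    P2_bound hu hax hζ01 hZ₁ hK hD₁ hD₂ hZ₁0 h1 h2,
    P3_bound hu hax hζ hZ₁ hZ₂ hQ₀ hQ₁ hK hD₀ hD₁ hZ₁0 hQ₀0 h0 h1 h2,
    P4_bound hu hax hζ hζax hZ₁ hZ₂ hZ₃ hK hZ₁0 hZ₂0 hZ₃0 h0 h1 h2,
    fun x hx => (L_bound hu hax hK h0 h2 x hx).1, fun x hx => (L_bound hu hax hK h0 h2 x hx).2⟩

end Pointwise

end Summit.NavierStokesRegularity.NavierStokesRegularity.Theorems.AxisymmetricKatoGlobal.EulerScaling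

end
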